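import Summits.CriticalPhenomena.PercolationContinuityZ3.Theorems.PercNearOneGluingNoHeavyLowerTailKnQuestion8CoefficientwiseCoreClassKernelMixBundleIET
import HarnessLib

/-!
# THEOREM LP1(Θ) in the kernel, III: IET on every bundle for thread-additive levels (all up-sets)

Support file (`--supports stmt-CriticalPhenomena-4575`, closed), prover `prim-cplus-coupling` (gen 43).  No definitions, no notations, no named facts,
no sorries; standard axioms.  Memo `prim-cplus-coupling/A5-COUPLING-gen42.md` §7 Remark (iii), `A5-COUPLING-gen43.md`.

`…KernelMixBundleIET` (`iet_bundle_threadSupported`) proves the increasing-event transfer on an explicit bundle for a/b-levels supported on single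
threads.  The IET form is BILINEAR in the level triples `(h, hᵃ, hᵇ)` and `(k, kᵃ, kᵇ)` and its supply term is monotone in `h, k`; summing the
thread-supported theorem over all pairs of threads gives:
* `Coefficientwise.iet_bundle_threadAdditive` — **COROLLARY (IET on bundles, thread-additive levels)**: for families `hᵃ_t, hᵇ_t ≤ h_t` supported
  on the vertices of thread `t` (monotone, nonnegative; `h_t` monotone, arbitrary support) and `kᵃ_t, kᵇ_t ≤ k_t` likewise, and any `h ≥ Σ_t h_t`,
  `k ≥ Σ_t k_t`, the IET sum with `hᵃ = Σ_t hᵃ_t`, `hᵇ = Σ_t hᵇ_t`, `kᵃ = Σ_t kᵃ_t`, `kᵇ = Σ_t kᵇ_t` is nonnegative for EVERY up-closed event.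
  This covers all MODULAR levels `h(S) = Σ_{v ∈ S} w_v`, `hᵃ(S) = Σ_v wᵃ_v`, `hᵇ(S) = Σ_v wᵇ_v` with `0 ≤ wᵃ_v, wᵇ_v ≤ w_v` (hub weights assigned to
  any one thread), e.g. `|C_u|`, `Σ_x a_x 1[x ∈ C_u]`, and equal thread-additive levels.
[cite: KozmaNitzan2024, Questions 8–9 (§5.5 p. 36) (context); Harris 1960]
-/

namespace Summit.CriticalPhenomena.PercolationContinuityZ3.Theorems

open Finset Literature.Probability.Percolation

namespace Coefficientwise

variable {ι V : Type*}

open Classical in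
/-- **COROLLARY (IET on every bundle for thread-additive levels; all up-sets).**  Explicit bundle as in `iet_bundle_threadSupported`.  Let
`h_t, k_t : Set V → ℝ` (`t < r`) be monotone, `0 ≤ hᵃ_t, hᵇ_t ≤ h_t` and `0 ≤ kᵃ_t, kᵇ_t ≤ k_t` monotone with `hᵃ_t, hᵇ_t, kᵃ_t, kᵇ_t` depending only
on the trace on the vertices of thread `t`, and let `h ≥ Σ_{t<r} h_t`, `k ≥ Σ_{t<r} k_t` pointwise.  Then for every up-closed event `𝒱`:
  `0 ≤ Σ_{ω ⊆ E : 𝒱, b ∈ X∖Y} h(X)k(X) + Σ_{ω ⊆ E : 𝒱, b ∈ Y∖X} (Σ_t hᵃ_t(X) − Σ_t hᵇ_t(Y))(Σ_t kᵃ_t(X) − Σ_t kᵇ_t(Y))`  (`X = C_u ω`, `Y = C_u(E∖ω)`).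
Proof: bilinearity + `iet_bundle_threadSupported` for every pair of threads `(p, q)` + `(Σ h_t)(Σ k_t) ≤ hk` on the supply.
[cite: KozmaNitzan2024, Questions 8–9 (§5.5 p. 36) (context); Harris 1960] -/
theorem iet_bundle_threadAdditive (ends : ι → Sym2 V) (r : ℕ) (L : ℕ → ℕ) (hL : ∀ t, t < r → 1 ≤ L t)
    (w : ℕ → ℕ → V) (e : ℕ → ℕ → ι) (u b : V)
    (hw0 : ∀ t, t < r → w t 0 = u) (hwL : ∀ t, t < r → w t (L t) = b)
    (harc : ∀ t, t < r → ∀ j, 1 ≤ j → j ≤ L t → ends (e t j) = s(w t (j - 1), w t j))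
    (hwinj : ∀ t, t < r → ∀ i j, i ≤ L t → j ≤ L t → w t i = w t j → i = j)
    (hcross : ∀ t t', t < r → t' < r → t ≠ t' → ∀ i j, i ≤ L t → j ≤ L t' → w t i = w t' j → (i = 0 ∧ j = 0) ∨ (i = L t ∧ j = L t'))
    (A : ℕ → Finset ι) (hA : ∀ t, t < r → ∀ i, i ∈ A t ↔ ∃ j, 1 ≤ j ∧ j ≤ L t ∧ e t j = i)
    (hAdisj : ∀ t t', t < r → t' < r → t ≠ t' → Disjoint (A t) (A t'))
    (E : Finset ι) (hEA : ∀ i, i ∈ E ↔ ∃ t, t < r ∧ i ∈ A t)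
    (𝒱 : Finset ι → Prop) (hV : ∀ ⦃s t : Finset ι⦄, s ⊆ t → 𝒱 s → 𝒱 t)
    (h k : Set V → ℝ) (hs ks has hbs kas kbs : ℕ → Set V → ℝ)
    (mhs : ∀ t, t < r → Monotone (hs t)) (mks : ∀ t, t < r → Monotone (ks t))
    (mhas : ∀ t, t < r → Monotone (has t)) (mhbs : ∀ t, t < r → Monotone (hbs t))
    (mkas : ∀ t, t < r → Monotone (kas t)) (mkbs : ∀ t, t < r → Monotone (kbs t))
    (has0 : ∀ t, t < r → ∀ S, 0 ≤ has t S) (hash : ∀ t, t < r → ∀ S, has t S ≤ hs t S)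
    (hbs0 : ∀ t, t < r → ∀ S, 0 ≤ hbs t S) (hbsh : ∀ t, t < r → ∀ S, hbs t S ≤ hs t S)
    (kas0 : ∀ t, t < r → ∀ S, 0 ≤ kas t S) (kask : ∀ t, t < r → ∀ S, kas t S ≤ ks t S)
    (kbs0 : ∀ t, t < r → ∀ S, 0 ≤ kbs t S) (kbsk : ∀ t, t < r → ∀ S, kbs t S ≤ ks t S)
    (shas : ∀ t, t < r → ∀ S S' : Set V, (∀ j, j ≤ L t → (w t j ∈ S ↔ w t j ∈ S')) → has t S = has t S')
    (shbs : ∀ t, t < r → ∀ S S' : Set V, (∀ j, j ≤ L t → (w t j ∈ S ↔ w t j ∈ S')) → hbs t S = hbs t S')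
    (skas : ∀ t, t < r → ∀ S S' : Set V, (∀ j, j ≤ L t → (w t j ∈ S ↔ w t j ∈ S')) → kas t S = kas t S')
    (skbs : ∀ t, t < r → ∀ S S' : Set V, (∀ j, j ≤ L t → (w t j ∈ S ↔ w t j ∈ S')) → kbs t S = kbs t S')
    (hsum : ∀ S, ∑ t ∈ Finset.range r, hs t S ≤ h S) (ksum : ∀ S, ∑ t ∈ Finset.range r, ks t S ≤ k S) :
    0 ≤ (∑ ω ∈ E.powerset, if 𝒱 ω ∧ b ∈ openCluster (ends '' (↑ω : Set ι)) u ∧ b ∉ openCluster (ends '' (↑(E \ ω) : Set ι)) u then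
        h (openCluster (ends '' (↑ω : Set ι)) u) * k (openCluster (ends '' (↑ω : Set ι)) u) else 0)
      + ∑ ω ∈ E.powerset, if 𝒱 ω ∧ b ∈ openCluster (ends '' (↑(E \ ω) : Set ι)) u ∧ b ∉ openCluster (ends '' (↑ω : Set ι)) u then
        ((∑ t ∈ Finset.range r, has t (openCluster (ends '' (↑ω : Set ι)) u))
            - ∑ t ∈ Finset.range r, hbs t (openCluster (ends '' (↑(E \ ω) : Set ι)) u)) *
          ((∑ t ∈ Finset.range r, kas t (openCluster (ends '' (↑ω : Set ι)) u))
            - ∑ t ∈ Finset.range r, kbs t (openCluster (ends '' (↑(E \ ω) : Set ι)) u)) else 0 := by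
  set C : Finset ι → Set V := fun ω => openCluster (ends '' (↑ω : Set ι)) u with hC
  -- every pair of threads
  have each : ∀ p ∈ Finset.range r, ∀ q ∈ Finset.range r,
      0 ≤ (∑ ω ∈ E.powerset, if 𝒱 ω ∧ b ∈ C ω ∧ b ∉ C (E \ ω) then hs p (C ω) * ks q (C ω) else 0)
        + ∑ ω ∈ E.powerset, if 𝒱 ω ∧ b ∈ C (E \ ω) ∧ b ∉ C ω then
          (has p (C ω) - hbs p (C (E \ ω))) * (kas q (C ω) - kbs q (C (E \ ω))) else 0 := by
    intro p hp' q hq'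
    have hp := Finset.mem_range.mp hp'
    have hq := Finset.mem_range.mp hq'
    exact iet_bundle_threadSupported ends r L hL w e u b hw0 hwL harc hwinj hcross A hA hAdisj E hEA p q hp hq 𝒱 hV
      (hs p) (ks q) (has p) (hbs p) (kas q) (kbs q) (mhs p hp) (mks q hq) (mhas p hp) (mhbs p hp) (mkas q hq) (mkbs q hq)
      (has0 p hp) (hash p hp) (hbs0 p hp) (hbsh p hp) (kas0 q hq) (kask q hq) (kbs0 q hq) (kbsk q hq)
      (shas p hp) (shbs p hp) (skas q hq) (skbs q hq)
  have total : 0 ≤ (∑ p ∈ Finset.range r, ∑ q ∈ Finset.range r,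
        ∑ ω ∈ E.powerset, if 𝒱 ω ∧ b ∈ C ω ∧ b ∉ C (E \ ω) then hs p (C ω) * ks q (C ω) else 0)
      + ∑ p ∈ Finset.range r, ∑ q ∈ Finset.range r, ∑ ω ∈ E.powerset, if 𝒱 ω ∧ b ∈ C (E \ ω) ∧ b ∉ C ω then
          (has p (C ω) - hbs p (C (E \ ω))) * (kas q (C ω) - kbs q (C (E \ ω))) else 0 := by
    rw [← Finset.sum_add_distrib]
    refine Finset.sum_nonneg fun p hp => ?_
    rw [← Finset.sum_add_distrib]
    exact Finset.sum_nonneg fun q hq => each p hp q hq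
  -- bilinearity: the double sums are the IET sums of the summed levels
  have eR : (∑ ω ∈ E.powerset, if 𝒱 ω ∧ b ∈ C ω ∧ b ∉ C (E \ ω) then
        (∑ p ∈ Finset.range r, hs p (C ω)) * (∑ q ∈ Finset.range r, ks q (C ω)) else 0)
      = ∑ p ∈ Finset.range r, ∑ q ∈ Finset.range r,
        ∑ ω ∈ E.powerset, if 𝒱 ω ∧ b ∈ C ω ∧ b ∉ C (E \ ω) then hs p (C ω) * ks q (C ω) else 0 := by
    have pt : ∀ ω ∈ E.powerset, (if 𝒱 ω ∧ b ∈ C ω ∧ b ∉ C (E \ ω) then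
          (∑ p ∈ Finset.range r, hs p (C ω)) * (∑ q ∈ Finset.range r, ks q (C ω)) else 0)
        = ∑ p ∈ Finset.range r, ∑ q ∈ Finset.range r, (if 𝒱 ω ∧ b ∈ C ω ∧ b ∉ C (E \ ω) then hs p (C ω) * ks q (C ω) else 0) := by
      intro ω _
      by_cases hR : 𝒱 ω ∧ b ∈ C ω ∧ b ∉ C (E \ ω)
      · simp only [if_pos hR]; rw [Finset.sum_mul_sum]
      · simp only [if_neg hR, Finset.sum_const_zero]
    rw [Finset.sum_congr rfl pt, Finset.sum_comm]
    refine Finset.sum_congr rfl fun p _ => ?_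
    rw [Finset.sum_comm]
  have eD : (∑ ω ∈ E.powerset, if 𝒱 ω ∧ b ∈ C (E \ ω) ∧ b ∉ C ω then
        ((∑ t ∈ Finset.range r, has t (C ω)) - ∑ t ∈ Finset.range r, hbs t (C (E \ ω))) *
          ((∑ t ∈ Finset.range r, kas t (C ω)) - ∑ t ∈ Finset.range r, kbs t (C (E \ ω))) else 0)
      = ∑ p ∈ Finset.range r, ∑ q ∈ Finset.range r, ∑ ω ∈ E.powerset, if 𝒱 ω ∧ b ∈ C (E \ ω) ∧ b ∉ C ω then
          (has p (C ω) - hbs p (C (E \ ω))) * (kas q (C ω) - kbs q (C (E \ ω))) else 0 := by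
    have pt : ∀ ω ∈ E.powerset, (if 𝒱 ω ∧ b ∈ C (E \ ω) ∧ b ∉ C ω then
          ((∑ t ∈ Finset.range r, has t (C ω)) - ∑ t ∈ Finset.range r, hbs t (C (E \ ω))) *
            ((∑ t ∈ Finset.range r, kas t (C ω)) - ∑ t ∈ Finset.range r, kbs t (C (E \ ω))) else 0)
        = ∑ p ∈ Finset.range r, ∑ q ∈ Finset.range r, (if 𝒱 ω ∧ b ∈ C (E \ ω) ∧ b ∉ C ω then
            (has p (C ω) - hbs p (C (E \ ω))) * (kas q (C ω) - kbs q (C (E \ ω))) else 0) := by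
      intro ω _
      by_cases hD : 𝒱 ω ∧ b ∈ C (E \ ω) ∧ b ∉ C ω
      · simp only [if_pos hD]; rw [← Finset.sum_sub_distrib, ← Finset.sum_sub_distrib, Finset.sum_mul_sum]
      · simp only [if_neg hD, Finset.sum_const_zero]
    rw [Finset.sum_congr rfl pt, Finset.sum_comm]
    refine Finset.sum_congr rfl fun p _ => ?_
    rw [Finset.sum_comm]
  -- the supply of the summed levels is at most `hk`
  have eS : (∑ ω ∈ E.powerset, if 𝒱 ω ∧ b ∈ C ω ∧ b ∉ C (E \ ω) then
        (∑ p ∈ Finset.range r, hs p (C ω)) * (∑ q ∈ Finset.range r, ks q (C ω)) else 0)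
      ≤ ∑ ω ∈ E.powerset, if 𝒱 ω ∧ b ∈ C ω ∧ b ∉ C (E \ ω) then h (C ω) * k (C ω) else 0 := by
    refine Finset.sum_le_sum fun ω _ => ?_
    by_cases hR : 𝒱 ω ∧ b ∈ C ω ∧ b ∉ C (E \ ω)
    · rw [if_pos hR, if_pos hR]
      have hs0 : 0 ≤ ∑ p ∈ Finset.range r, hs p (C ω) :=
        Finset.sum_nonneg fun p hp => le_trans (has0 p (Finset.mem_range.mp hp) _) (hash p (Finset.mem_range.mp hp) _)
      have ks0 : 0 ≤ ∑ q ∈ Finset.range r, ks q (C ω) :=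
        Finset.sum_nonneg fun q hq => le_trans (kas0 q (Finset.mem_range.mp hq) _) (kask q (Finset.mem_range.mp hq) _)
      exact mul_le_mul (hsum _) (ksum _) ks0 (le_trans hs0 (hsum _))
    · rw [if_neg hR, if_neg hR]
  rw [← eR, ← eD] at total
  linarith

end Coefficientwise

end Summit.CriticalPhenomena.PercolationContinuityZ3.Theorems
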